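import Literature.AnabelianGeometry.SemiGraphs.TemperedAnchoredCompactOfTopCyclic
import Literature.AnabelianGeometry.SemiGraphs.TemperedCompactVerticialOrCommutative
import Literature.AnabelianGeometry.SemiGraphs.TemperedReconstructionCor39IsoFiniteVertices
import Literature.AnabelianGeometry.SemiGraphs.TemperedReconstructionReductionsProofs
import Literature.AnabelianGeometry.SemiGraphs.TemperedReconstructionEdgeVertexProofs
import Literature.AnabelianGeometry.SemiGraphs.TemperedEdgeLikeIsInfVerticialHolds
import Literature.AnabelianGeometry.SemiGraphs.MetabelianLeafStarVerticialCharacterization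
import HarnessLib

/-!
# On the class «TOP-CYCLIC», VERTICIAL = MAXIMAL COMPACT ∧ NON-COMMUTATIVE — so every isomorphism of
# chart groups permutes verticial subgroups, vertices and edge-like subgroups
# ([SemiAnbd] Thm 3.7 (iv) p. 41; proof of Cor 3.9 (b) p. 43, steps 1–2, for isomorphisms)

Mochizuki, *Semi-graphs of anabelioids*, Publ. RIMS **42** (2006), §3, Theorem 3.7 (iv) p. 41 ("the maximal compact
subgroups of `π₁^temp(𝒢)` are precisely the verticial subgroups"; "the nontrivial intersections of two distinct
maximal compact subgroups are precisely the edge-like subgroups") and the proof of Corollary 3.9 p. 43 ("preserves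
verticial subgroups [cf. Theorem 3.7, (iv)] … induces a morphism on underlying semi-graphs")
[cite: MochizukiSemiAnbd2006, Thm 3.7(iv) p.41] [cite: MochizukiSemiAnbd2006, Cor 3.9 p.43].

PROOF-ONLY file (abc-iut cell, layer L3, seat abc-iut-L3-t5 gen 15, row «VERT⟺NONCOMM-MAXCPT@TOP-CYCLIC»; no
definition, no named fact).  The CLASS twin of abc-iut-L3-t8's star file `MetabelianLeafStarVerticialCharacterization`
(p500569).  The class of record «TOP-CYCLIC»: every countable graph of anabelioids `𝒢` satisfying the hypotheses of
Thm. 3.7 (`Thm37Hypotheses`) ALL of whose edge groups are topologically cyclic — NO condition on the underlying graph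
(infinite valence, infinitely-branching cores, rayless stars).  On this class the first sentence of Thm. 3.7 (iv) CAN
FAIL (abc-iut-L3-t8, `metabelianLeafStar_not_maximalCompactIffVerticialAt`: at `𝒢⋆(p)` the escaping procyclic
`⟨c⟩‾ ≅ ℤ_p` is an exotic maximal compact subgroup), but abc-iut-w6-d064 showed «verticial ⇒ maximal compact»
(`isMaximalCompactSubgroup_of_mem_verticialSubgroups_of_topCyclic`) and «maximal compact ⇒ verticial OR
commutative» (`TemperedCompactVerticialOrCommutative`, edge groups commutative).  Adding that verticial subgroups are
NON-commutative (vertex groups are slim — `Prop36Hypotheses.isVerticiallySlim` — and infinite — totally elevated,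
`infinite_gv_of_isElevatedVertex` — and verticial homomorphisms are injective, Thm. 3.7 (i) `verticialInjective_holds`):

* `exists_not_commute_of_mem_verticialSubgroups`, `ne_bot_of_mem_verticialSubgroups` (any `𝒢` as in Thm. 3.7);
* ★ `exists_mem_verticialSubgroups_iff_isMaximalCompactSubgroup_and_not_commutative_of_topCyclic` — **`H` is
  verticial (for some vertex) iff `H` is a maximal compact subgroup with two non-commuting elements**, a
  characterisation in the language of the TOPOLOGICAL GROUP alone; dually, for a maximal compact `K`: exotic (in no
  `verticialSubgroups c v`) iff commutative;
* ★ `map_mem_verticialSubgroups_of_continuousMulEquiv_of_topCyclic` — for ANY two graphs `𝒢`, `ℋ` of the class,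
  charts `c`, `c'`, and every isomorphism of topological groups `e : c.G ≃ₜ* c'.G`: `e` carries verticial subgroups of
  `π₁^temp(𝒢)` to verticial subgroups of `π₁^temp(ℋ)`, at a UNIQUE vertex (`existsUnique_…`, Thm. 3.7 (ii)); the
  two-sided and automorphism forms;
* ★ `exists_vertexEquiv_of_continuousMulEquiv_of_topCyclic` — `e` induces a BIJECTION `𝒢.graph.Vertex ≃ ℋ.graph.Vertex`
  compatible with `e` / `e⁻¹` on verticial subgroups (∃-form) — abc-iut-w4-d083's finite
  `vertexMap_bijective_of_compatV_equiv` freed from finiteness and from Thm. 3.7 (iv);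
* `map_mem_edgeLikeSubgroups_of_continuousMulEquiv_of_topCyclic` — `e` carries every nontrivial edge-like subgroup
  of a CLOSED edge of `𝒢` to an edge-like subgroup of a closed edge of `ℋ` (Thm. 3.7 (iv) sentence 2 both ways on the
  class, abc-iut-w6-d064 + abc-iut-f-173's `edgeLikeIsInfVerticialAt_holds`); two-sided form.

These are steps 1–2 of the printed proof of Cor. 3.9 (b) p. 43 for ISOMORPHISMS, on the whole class and WITHOUT
Thm. 3.7 (iii)/(iv) on either side (the cell's Cor-3.9 closers take (iii) on the side receiving `φ`; for an
isomorphism the classification above replaces it).  Honest framing: theorems about OUR typed tempered fundamental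
group of OUR countable carriers; print's Thm. 3.7 (iv) / Cor. 3.9 at finite `𝔾` untouched (there (iv) is a tree
theorem); outside the [IUTchIII] Cor. 3.12 cone; no side taken; typed ≠ proved.
-/

noncomputable section

open CategoryTheory Topology

namespace Literature.AnabelianGeometry.SemiGraphs

namespace ProfiniteSemiGraph

open Literature.AlgebraicGeometry.Frobenioids (IsSlimGroup)

universe u

variable {𝒢 ℋ : ProfiniteSemiGraph.{u}}

/-! ### Verticial subgroups are non-commutative (any `𝒢` as in Thm. 3.7) -/

/-- Every vertex group of a `𝒢` as in Prop. 3.6 has a nontrivial element (it is infinite: the vertex is elevated,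
`infinite_gv_of_isElevatedVertex`). [cite: MochizukiSemiAnbd2006, Def 2.4(i) p.25] -/
theorem exists_ne_one_gv (h36 : 𝒢.Prop36Hypotheses) (v : 𝒢.graph.Vertex) : ∃ x : 𝒢.Gv v, x ≠ 1 :=
  haveI := infinite_gv_of_isElevatedVertex (h36.isTotallyElevated v)
  exists_ne 1

/-- **Verticial subgroups of `π₁^temp(𝒢)` are NON-commutative** (every `𝒢` as in Thm. 3.7, every chart): the vertex
group `Π_v` is slim (verticially slim) with a nontrivial element (elevated), hence has two non-commuting elements
(`exists_not_commute_of_isSlimGroup`), and the verticial homomorphism `Π_v → π₁^temp(𝒢)` is injective (Thm. 3.7 (i),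
`verticialInjective_holds`). [cite: MochizukiSemiAnbd2006, Thm 3.7(i) p.40] -/
theorem exists_not_commute_of_mem_verticialSubgroups (h37 : 𝒢.Thm37Hypotheses) (c : TemperedPiChart 𝒢)
    {v : 𝒢.graph.Vertex} {H : Subgroup c.G} (hH : H ∈ verticialSubgroups c v) :
    ∃ g₁ ∈ H, ∃ g₂ ∈ H, g₁ * g₂ ≠ g₂ * g₁ := by
  obtain ⟨ψ, hψ, rfl⟩ := hH
  have hinj : Function.Injective ψ := (verticialInjective_holds 𝒢 h37 c v).2 ψ hψ
  obtain ⟨x, hx⟩ := exists_ne_one_gv h37.toProp36Hypotheses v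
  obtain ⟨y, hxy⟩ := exists_not_commute_of_isSlimGroup (h37.isVerticiallySlim v) hx
  refine ⟨ψ x, ⟨x, rfl⟩, ψ y, ⟨y, rfl⟩, fun h => hxy (hinj ?_)⟩
  simpa only [map_mul] using h

/-- Verticial subgroups are nontrivial (every `𝒢` as in Thm. 3.7, every chart). [cite: MochizukiSemiAnbd2006, Thm 3.7(i) p.40] -/
theorem ne_bot_of_mem_verticialSubgroups (h37 : 𝒢.Thm37Hypotheses) (c : TemperedPiChart 𝒢)
    {v : 𝒢.graph.Vertex} {H : Subgroup c.G} (hH : H ∈ verticialSubgroups c v) : H ≠ ⊥ := by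
  obtain ⟨g₁, hg₁, g₂, hg₂, hne⟩ := exists_not_commute_of_mem_verticialSubgroups h37 c hH
  rintro rfl
  rw [Subgroup.mem_bot] at hg₁ hg₂
  rw [hg₁, hg₂] at hne
  exact hne rfl

/-! ### The topological characterisation of the verticial subgroups on «TOP-CYCLIC» -/

/-- **On «TOP-CYCLIC», VERTICIAL ⟺ MAXIMAL COMPACT ∧ NON-COMMUTATIVE** (every countable `𝒢` as in Thm. 3.7 all of
whose edge groups are topologically cyclic, any underlying graph, every chart): a subgroup of `π₁^temp(𝒢)` is verticial
(for some vertex) iff it is a maximal compact subgroup containing two non-commuting elements.  (⟹: abc-iut-w6-d064's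
`isMaximalCompactSubgroup_of_mem_verticialSubgroups_of_topCyclic` and the preceding theorem; ⟸: abc-iut-w6-d064's
`exists_mem_verticialSubgroups_of_isMaximalCompactSubgroup_of_not_commutative_of_commEdges`, topologically cyclic edge
groups being commutative, `commEdges_of_topCyclic`.)  This is what survives of the first sentence of Thm. 3.7 (iv) on
the class — where that sentence itself can fail (`𝒢⋆(p)`). [cite: MochizukiSemiAnbd2006, Thm 3.7(iv) p.41] -/
theorem exists_mem_verticialSubgroups_iff_isMaximalCompactSubgroup_and_not_commutative_of_topCyclic
    (h37 : 𝒢.Thm37Hypotheses)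
    (hcyc : ∀ e : 𝒢.graph.Edge, ∃ t₀ : 𝒢.Ge e, (Subgroup.zpowers t₀).topologicalClosure = ⊤)
    (c : TemperedPiChart 𝒢) (H : Subgroup c.G) :
    (∃ v : 𝒢.graph.Vertex, H ∈ verticialSubgroups c v) ↔
      IsMaximalCompactSubgroup H ∧ ∃ g₁ ∈ H, ∃ g₂ ∈ H, g₁ * g₂ ≠ g₂ * g₁ := by
  constructor
  · rintro ⟨v, hH⟩
    exact ⟨𝒢.isMaximalCompactSubgroup_of_mem_verticialSubgroups_of_topCyclic h37 hcyc c hH,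
      exists_not_commute_of_mem_verticialSubgroups h37 c hH⟩
  · rintro ⟨hK, hK'⟩
    exact exists_mem_verticialSubgroups_of_isMaximalCompactSubgroup_of_not_commutative_of_commEdges
      h37.toProp36Hypotheses (𝒢.commEdges_of_topCyclic hcyc) c H hK hK'

/-- **Dually: on «TOP-CYCLIC», a maximal compact subgroup is EXOTIC (verticial at no vertex) iff it is COMMUTATIVE**
(every chart).  (⟹: abc-iut-w6-d064's `mem_verticialSubgroups_or_anchorFree_and_commutative_of_isMaximalCompactSubgroup_of_topCyclic`;
⟸: verticial subgroups are non-commutative.) [cite: MochizukiSemiAnbd2006, Thm 3.7(iv) p.41] -/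
theorem forall_not_mem_verticialSubgroups_iff_commutative_of_isMaximalCompactSubgroup_of_topCyclic
    (h37 : 𝒢.Thm37Hypotheses)
    (hcyc : ∀ e : 𝒢.graph.Edge, ∃ t₀ : 𝒢.Ge e, (Subgroup.zpowers t₀).topologicalClosure = ⊤)
    (c : TemperedPiChart 𝒢) {K : Subgroup c.G} (hK : IsMaximalCompactSubgroup K) :
    (∀ v : 𝒢.graph.Vertex, K ∉ verticialSubgroups c v) ↔ ∀ g₁ ∈ K, ∀ g₂ ∈ K, g₁ * g₂ = g₂ * g₁ := by
  constructor
  · intro hno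
    rcases 𝒢.mem_verticialSubgroups_or_anchorFree_and_commutative_of_isMaximalCompactSubgroup_of_topCyclic
        h37 hcyc c K hK with ⟨v, hv⟩ | ⟨-, hcomm⟩
    · exact absurd hv (hno v)
    · exact hcomm
  · intro hcomm v hv
    obtain ⟨g₁, hg₁, g₂, hg₂, hne⟩ := exists_not_commute_of_mem_verticialSubgroups h37 c hv
    exact hne (hcomm g₁ hg₁ g₂ hg₂)

/-- **On «TOP-CYCLIC», every maximal compact subgroup is verticial or commutative, and not both** (every chart) —
the exclusive form of abc-iut-w6-d064's dichotomy. [cite: MochizukiSemiAnbd2006, Thm 3.7(iv) p.41] -/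
theorem exists_mem_verticialSubgroups_xor_commutative_of_isMaximalCompactSubgroup_of_topCyclic
    (h37 : 𝒢.Thm37Hypotheses)
    (hcyc : ∀ e : 𝒢.graph.Edge, ∃ t₀ : 𝒢.Ge e, (Subgroup.zpowers t₀).topologicalClosure = ⊤)
    (c : TemperedPiChart 𝒢) {K : Subgroup c.G} (hK : IsMaximalCompactSubgroup K) :
    Xor (∃ v : 𝒢.graph.Vertex, K ∈ verticialSubgroups c v) (∀ g₁ ∈ K, ∀ g₂ ∈ K, g₁ * g₂ = g₂ * g₁) := by
  by_cases h : ∃ v : 𝒢.graph.Vertex, K ∈ verticialSubgroups c v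
  · refine Or.inl ⟨h, fun hcomm => ?_⟩
    obtain ⟨v, hv⟩ := h
    obtain ⟨g₁, hg₁, g₂, hg₂, hne⟩ := exists_not_commute_of_mem_verticialSubgroups h37 c hv
    exact hne (hcomm g₁ hg₁ g₂ hg₂)
  · refine Or.inr ⟨?_, h⟩
    exact (forall_not_mem_verticialSubgroups_iff_commutative_of_isMaximalCompactSubgroup_of_topCyclic h37 hcyc
      c hK).mp fun v hv => h ⟨v, hv⟩

/-! ### Isomorphisms of chart groups carry verticial subgroups to verticial subgroups -/

/-- **Every isomorphism of topological groups between chart groups of two graphs of the class «TOP-CYCLIC» carries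
verticial subgroups to verticial subgroups** — the first step of the proof of Cor. 3.9 (b) ("preserves verticial
subgroups [cf. Theorem 3.7, (iv)]"), obtained for isomorphisms on the whole class WITHOUT the first sentence of Thm.
3.7 (iv): maximal compactness (`IsMaximalCompactSubgroup.map_equiv`) and non-commutativity are invariants of the
topological group. [cite: MochizukiSemiAnbd2006, Cor 3.9 p.43] -/
theorem map_mem_verticialSubgroups_of_continuousMulEquiv_of_topCyclic
    (h𝒢 : 𝒢.Thm37Hypotheses) (hℋ : ℋ.Thm37Hypotheses)
    (hcyc𝒢 : ∀ e : 𝒢.graph.Edge, ∃ t₀ : 𝒢.Ge e, (Subgroup.zpowers t₀).topologicalClosure = ⊤)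
    (hcycℋ : ∀ e : ℋ.graph.Edge, ∃ t₀ : ℋ.Ge e, (Subgroup.zpowers t₀).topologicalClosure = ⊤)
    (c : TemperedPiChart 𝒢) (c' : TemperedPiChart ℋ) (e : c.G ≃ₜ* c'.G)
    {v : 𝒢.graph.Vertex} {H : Subgroup c.G} (hH : H ∈ verticialSubgroups c v) :
    ∃ w : ℋ.graph.Vertex, H.map e.toMonoidHom ∈ verticialSubgroups c' w := by
  obtain ⟨hK, g₁, hg₁, g₂, hg₂, hne⟩ :=
    (exists_mem_verticialSubgroups_iff_isMaximalCompactSubgroup_and_not_commutative_of_topCyclic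
      h𝒢 hcyc𝒢 c H).mp ⟨v, hH⟩
  refine (exists_mem_verticialSubgroups_iff_isMaximalCompactSubgroup_and_not_commutative_of_topCyclic
      hℋ hcycℋ c' _).mpr ⟨IsMaximalCompactSubgroup.map_equiv e hK, e g₁, ⟨g₁, hg₁, rfl⟩, e g₂, ⟨g₂, hg₂, rfl⟩,
        fun h => hne (e.injective ?_)⟩
  simpa only [map_mul] using h

/-- **… at a UNIQUE vertex of `ℋ`** (a verticial subgroup determines its vertex, Thm. 3.7 (ii),
`vertex_eq_of_mem_verticialSubgroups`). [cite: MochizukiSemiAnbd2006, Cor 3.9 p.43] -/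
theorem existsUnique_map_mem_verticialSubgroups_of_continuousMulEquiv_of_topCyclic
    (h𝒢 : 𝒢.Thm37Hypotheses) (hℋ : ℋ.Thm37Hypotheses)
    (hcyc𝒢 : ∀ e : 𝒢.graph.Edge, ∃ t₀ : 𝒢.Ge e, (Subgroup.zpowers t₀).topologicalClosure = ⊤)
    (hcycℋ : ∀ e : ℋ.graph.Edge, ∃ t₀ : ℋ.Ge e, (Subgroup.zpowers t₀).topologicalClosure = ⊤)
    (c : TemperedPiChart 𝒢) (c' : TemperedPiChart ℋ) (e : c.G ≃ₜ* c'.G)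
    {v : 𝒢.graph.Vertex} {H : Subgroup c.G} (hH : H ∈ verticialSubgroups c v) :
    ∃! w : ℋ.graph.Vertex, H.map e.toMonoidHom ∈ verticialSubgroups c' w := by
  obtain ⟨w, hw⟩ := map_mem_verticialSubgroups_of_continuousMulEquiv_of_topCyclic h𝒢 hℋ hcyc𝒢 hcycℋ c c' e hH
  exact ⟨w, hw, fun w' hw' => vertex_eq_of_mem_verticialSubgroups hℋ c' hw' hw⟩

/-- **Two-sided form**: `H ≤ π₁^temp(𝒢)` is verticial iff `e(H) ≤ π₁^temp(ℋ)` is, for every isomorphism of topological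
groups `e` between chart groups of two graphs of the class «TOP-CYCLIC». [cite: MochizukiSemiAnbd2006, Cor 3.9 p.43] -/
theorem exists_mem_verticialSubgroups_map_continuousMulEquiv_iff_of_topCyclic
    (h𝒢 : 𝒢.Thm37Hypotheses) (hℋ : ℋ.Thm37Hypotheses)
    (hcyc𝒢 : ∀ e : 𝒢.graph.Edge, ∃ t₀ : 𝒢.Ge e, (Subgroup.zpowers t₀).topologicalClosure = ⊤)
    (hcycℋ : ∀ e : ℋ.graph.Edge, ∃ t₀ : ℋ.Ge e, (Subgroup.zpowers t₀).topologicalClosure = ⊤)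
    (c : TemperedPiChart 𝒢) (c' : TemperedPiChart ℋ) (e : c.G ≃ₜ* c'.G) (H : Subgroup c.G) :
    (∃ w : ℋ.graph.Vertex, H.map e.toMonoidHom ∈ verticialSubgroups c' w) ↔
      ∃ v : 𝒢.graph.Vertex, H ∈ verticialSubgroups c v := by
  refine ⟨fun ⟨w, hw⟩ => ?_,
    fun ⟨v, hv⟩ => map_mem_verticialSubgroups_of_continuousMulEquiv_of_topCyclic h𝒢 hℋ hcyc𝒢 hcycℋ c c' e hv⟩
  obtain ⟨v, hv⟩ :=
    map_mem_verticialSubgroups_of_continuousMulEquiv_of_topCyclic hℋ h𝒢 hcycℋ hcyc𝒢 c' c e.symm hw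
  exact ⟨v, by rwa [map_symm_map_equiv] at hv⟩

/-- **Automorphism form**: every bicontinuous automorphism `α` of a chart group of `π₁^temp(𝒢)`, `𝒢` in the class
«TOP-CYCLIC», permutes the set of verticial subgroups: `α(H)` is verticial iff `H` is.
[cite: MochizukiSemiAnbd2006, Cor 3.9 p.43] -/
theorem exists_mem_verticialSubgroups_map_aut_iff_of_topCyclic (h𝒢 : 𝒢.Thm37Hypotheses)
    (hcyc𝒢 : ∀ e : 𝒢.graph.Edge, ∃ t₀ : 𝒢.Ge e, (Subgroup.zpowers t₀).topologicalClosure = ⊤)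
    (c : TemperedPiChart 𝒢) (α : c.G ≃ₜ* c.G) (H : Subgroup c.G) :
    (∃ v : 𝒢.graph.Vertex, H.map α.toMonoidHom ∈ verticialSubgroups c v) ↔
      ∃ v : 𝒢.graph.Vertex, H ∈ verticialSubgroups c v :=
  exists_mem_verticialSubgroups_map_continuousMulEquiv_iff_of_topCyclic h𝒢 h𝒢 hcyc𝒢 hcyc𝒢 c c α H

/-- **Exotic maximal compact subgroups go to exotic maximal compact subgroups** under every isomorphism of chart
groups of two graphs of the class «TOP-CYCLIC» (maximal compactness and commutativity are invariants).
[cite: MochizukiSemiAnbd2006, Thm 3.7(iv) p.41] -/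
theorem map_exotic_of_continuousMulEquiv_of_topCyclic
    (h𝒢 : 𝒢.Thm37Hypotheses) (hℋ : ℋ.Thm37Hypotheses)
    (hcyc𝒢 : ∀ e : 𝒢.graph.Edge, ∃ t₀ : 𝒢.Ge e, (Subgroup.zpowers t₀).topologicalClosure = ⊤)
    (hcycℋ : ∀ e : ℋ.graph.Edge, ∃ t₀ : ℋ.Ge e, (Subgroup.zpowers t₀).topologicalClosure = ⊤)
    (c : TemperedPiChart 𝒢) (c' : TemperedPiChart ℋ) (e : c.G ≃ₜ* c'.G)
    {K : Subgroup c.G} (hK : IsMaximalCompactSubgroup K) (hKex : ∀ v : 𝒢.graph.Vertex, K ∉ verticialSubgroups c v) :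
    IsMaximalCompactSubgroup (K.map e.toMonoidHom) ∧
      ∀ w : ℋ.graph.Vertex, K.map e.toMonoidHom ∉ verticialSubgroups c' w := by
  refine ⟨IsMaximalCompactSubgroup.map_equiv e hK, fun w hw => ?_⟩
  obtain ⟨v, hv⟩ := (exists_mem_verticialSubgroups_map_continuousMulEquiv_iff_of_topCyclic h𝒢 hℋ hcyc𝒢 hcycℋ
    c c' e K).mp ⟨w, hw⟩
  exact hKex v hv

/-! ### The induced bijection of vertices -/

/-- **An isomorphism of chart groups of two graphs `𝒢`, `ℋ` of the class «TOP-CYCLIC» induces a BIJECTION of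
vertices** `f : 𝒢.graph.Vertex ≃ ℋ.graph.Vertex`, characterised by: `e` carries the verticial subgroups at `v` to
verticial subgroups at `f v`, and `e⁻¹` those at `w` to verticial subgroups at `f⁻¹ w` ("induces a morphism on
underlying semi-graphs", proof of Cor. 3.9 p. 43 — here for isomorphisms, on vertices, without Thm. 3.7 (iv);
abc-iut-w4-d083's finite `vertexMap_bijective_of_compatV_equiv` is the case of finite graphs with a given compatible
`F`).  Well-definedness: verticial subgroups at one vertex are conjugate (`exists_conj_of_mem_verticialSubgroups`) and
a verticial subgroup determines its vertex (Thm. 3.7 (ii)). [cite: MochizukiSemiAnbd2006, Cor 3.9 p.43] -/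
theorem exists_vertexEquiv_of_continuousMulEquiv_of_topCyclic
    (h𝒢 : 𝒢.Thm37Hypotheses) (hℋ : ℋ.Thm37Hypotheses)
    (hcyc𝒢 : ∀ e : 𝒢.graph.Edge, ∃ t₀ : 𝒢.Ge e, (Subgroup.zpowers t₀).topologicalClosure = ⊤)
    (hcycℋ : ∀ e : ℋ.graph.Edge, ∃ t₀ : ℋ.Ge e, (Subgroup.zpowers t₀).topologicalClosure = ⊤)
    (c : TemperedPiChart 𝒢) (c' : TemperedPiChart ℋ) (e : c.G ≃ₜ* c'.G) :
    ∃ f : 𝒢.graph.Vertex ≃ ℋ.graph.Vertex,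
      (∀ (v : 𝒢.graph.Vertex) (H : Subgroup c.G), H ∈ verticialSubgroups c v →
        H.map e.toMonoidHom ∈ verticialSubgroups c' (f v)) ∧
      ∀ (w : ℋ.graph.Vertex) (K : Subgroup c'.G), K ∈ verticialSubgroups c' w →
        K.map e.symm.toMonoidHom ∈ verticialSubgroups c (f.symm w) := by
  -- the forward vertex function: all verticial subgroups at `v` are conjugate, so they land at one vertex
  have hfwd : ∀ v : 𝒢.graph.Vertex, ∃ w : ℋ.graph.Vertex, ∀ H : Subgroup c.G, H ∈ verticialSubgroups c v →
      H.map e.toMonoidHom ∈ verticialSubgroups c' w := by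
    intro v
    obtain ⟨H₀, hH₀⟩ := (verticialInjective_holds 𝒢 h𝒢 c v).1
    obtain ⟨w, hw⟩ := map_mem_verticialSubgroups_of_continuousMulEquiv_of_topCyclic h𝒢 hℋ hcyc𝒢 hcycℋ c c' e hH₀
    refine ⟨w, fun H hH => ?_⟩
    obtain ⟨g, rfl⟩ := exists_conj_of_mem_verticialSubgroups c hH₀ hH
    rw [map_conj_map_equiv]
    exact conj_mem_verticialSubgroups c' hw _
  have hbwd : ∀ w : ℋ.graph.Vertex, ∃ v : 𝒢.graph.Vertex, ∀ K : Subgroup c'.G, K ∈ verticialSubgroups c' w →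
      K.map e.symm.toMonoidHom ∈ verticialSubgroups c v := by
    intro w
    obtain ⟨K₀, hK₀⟩ := (verticialInjective_holds ℋ hℋ c' w).1
    obtain ⟨v, hv⟩ :=
      map_mem_verticialSubgroups_of_continuousMulEquiv_of_topCyclic hℋ h𝒢 hcycℋ hcyc𝒢 c' c e.symm hK₀
    refine ⟨v, fun K hK => ?_⟩
    obtain ⟨g, rfl⟩ := exists_conj_of_mem_verticialSubgroups c' hK₀ hK
    rw [map_conj_map_equiv]
    exact conj_mem_verticialSubgroups c hv _
  choose f hf using hfwd
  choose g hg using hbwd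
  have hgf : ∀ v, g (f v) = v := by
    intro v
    obtain ⟨H₀, hH₀⟩ := (verticialInjective_holds 𝒢 h𝒢 c v).1
    have h1 := hg (f v) _ (hf v H₀ hH₀)
    rw [map_symm_map_equiv] at h1
    exact vertex_eq_of_mem_verticialSubgroups h𝒢 c h1 hH₀
  have hfg : ∀ w, f (g w) = w := by
    intro w
    obtain ⟨K₀, hK₀⟩ := (verticialInjective_holds ℋ hℋ c' w).1
    have h1 := hf (g w) _ (hg w K₀ hK₀)
    rw [map_map_symm_equiv] at h1
    exact vertex_eq_of_mem_verticialSubgroups hℋ c' h1 hK₀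
  exact ⟨⟨f, g, hgf, hfg⟩, hf, hg⟩

/-- **Automorphism form**: every bicontinuous automorphism of a chart group of `π₁^temp(𝒢)`, `𝒢` in the class
«TOP-CYCLIC», induces a PERMUTATION of the vertices of `𝒢` compatible with it on verticial subgroups.
[cite: MochizukiSemiAnbd2006, Cor 3.9 p.43] -/
theorem exists_vertexPerm_of_continuousMulEquiv_of_topCyclic (h𝒢 : 𝒢.Thm37Hypotheses)
    (hcyc𝒢 : ∀ e : 𝒢.graph.Edge, ∃ t₀ : 𝒢.Ge e, (Subgroup.zpowers t₀).topologicalClosure = ⊤)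
    (c : TemperedPiChart 𝒢) (α : c.G ≃ₜ* c.G) :
    ∃ σ : Equiv.Perm 𝒢.graph.Vertex, ∀ (v : 𝒢.graph.Vertex) (H : Subgroup c.G), H ∈ verticialSubgroups c v →
      H.map α.toMonoidHom ∈ verticialSubgroups c (σ v) := by
  obtain ⟨f, hf, -⟩ := exists_vertexEquiv_of_continuousMulEquiv_of_topCyclic h𝒢 h𝒢 hcyc𝒢 hcyc𝒢 c c α
  exact ⟨f, hf⟩

/-- **The cardinality of the vertex set is an invariant of the topological group `π₁^temp`** on the class
«TOP-CYCLIC»: isomorphic chart groups have equinumerous vertex sets (`Nat.card`; `0` on both sides when infinite).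
[cite: MochizukiSemiAnbd2006, Cor 3.9 p.43] -/
theorem natCard_vertex_eq_of_continuousMulEquiv_of_topCyclic
    (h𝒢 : 𝒢.Thm37Hypotheses) (hℋ : ℋ.Thm37Hypotheses)
    (hcyc𝒢 : ∀ e : 𝒢.graph.Edge, ∃ t₀ : 𝒢.Ge e, (Subgroup.zpowers t₀).topologicalClosure = ⊤)
    (hcycℋ : ∀ e : ℋ.graph.Edge, ∃ t₀ : ℋ.Ge e, (Subgroup.zpowers t₀).topologicalClosure = ⊤)
    (c : TemperedPiChart 𝒢) (c' : TemperedPiChart ℋ) (e : c.G ≃ₜ* c'.G) :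
    Nat.card 𝒢.graph.Vertex = Nat.card ℋ.graph.Vertex := by
  obtain ⟨f, -, -⟩ := exists_vertexEquiv_of_continuousMulEquiv_of_topCyclic h𝒢 hℋ hcyc𝒢 hcycℋ c c' e
  exact Nat.card_congr f

/-- In particular `𝒢` has finitely many vertices iff `ℋ` does, whenever some chart groups of `π₁^temp(𝒢)` and
`π₁^temp(ℋ)` are isomorphic (both in the class «TOP-CYCLIC»). [cite: MochizukiSemiAnbd2006, Cor 3.9 p.43] -/
theorem finite_vertex_iff_of_continuousMulEquiv_of_topCyclic
    (h𝒢 : 𝒢.Thm37Hypotheses) (hℋ : ℋ.Thm37Hypotheses)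
    (hcyc𝒢 : ∀ e : 𝒢.graph.Edge, ∃ t₀ : 𝒢.Ge e, (Subgroup.zpowers t₀).topologicalClosure = ⊤)
    (hcycℋ : ∀ e : ℋ.graph.Edge, ∃ t₀ : ℋ.Ge e, (Subgroup.zpowers t₀).topologicalClosure = ⊤)
    (c : TemperedPiChart 𝒢) (c' : TemperedPiChart ℋ) (e : c.G ≃ₜ* c'.G) :
    Finite 𝒢.graph.Vertex ↔ Finite ℋ.graph.Vertex := by
  obtain ⟨f, -, -⟩ := exists_vertexEquiv_of_continuousMulEquiv_of_topCyclic h𝒢 hℋ hcyc𝒢 hcycℋ c c' e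
  exact Equiv.finite_iff f

/-! ### Isomorphisms of chart groups carry edge-like subgroups of closed edges to edge-like subgroups -/

/-- **Every isomorphism of chart groups of two graphs of the class «TOP-CYCLIC» carries every nontrivial edge-like
subgroup of a CLOSED edge of `𝒢` to an edge-like subgroup of a closed edge of `ℋ`** — the second step of the proof
of Cor. 3.9 (b) for isomorphisms: a nontrivial edge-like subgroup of a closed edge is `H₁ ⊓ H₂` for two distinct
verticial subgroups (abc-iut-f-173's `edgeLikeIsInfVerticialAt_holds`); their images are distinct verticial, hence
maximal compact, subgroups of `π₁^temp(ℋ)` whose (nontrivial, anchored) intersection is edge-like at a closed edge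
(abc-iut-w6-d064's `exists_mem_edgeLikeSubgroups_of_maximalCompact_inf_of_anchored_of_topCyclic`).
[cite: MochizukiSemiAnbd2006, Cor 3.9 p.43] -/
theorem map_mem_edgeLikeSubgroups_of_continuousMulEquiv_of_topCyclic
    (h𝒢 : 𝒢.Thm37Hypotheses) (hℋ : ℋ.Thm37Hypotheses)
    (hcyc𝒢 : ∀ e : 𝒢.graph.Edge, ∃ t₀ : 𝒢.Ge e, (Subgroup.zpowers t₀).topologicalClosure = ⊤)
    (hcycℋ : ∀ e : ℋ.graph.Edge, ∃ t₀ : ℋ.Ge e, (Subgroup.zpowers t₀).topologicalClosure = ⊤)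
    (c : TemperedPiChart 𝒢) (c' : TemperedPiChart ℋ) (e : c.G ≃ₜ* c'.G)
    {e₀ : 𝒢.graph.Edge} (he₀ : 𝒢.graph.IsClosedEdge e₀) {L : Subgroup c.G} (hL : L ∈ edgeLikeSubgroups c e₀)
    (hLne : L ≠ ⊥) :
    ∃ e₁ : ℋ.graph.Edge, ℋ.graph.IsClosedEdge e₁ ∧ L.map e.toMonoidHom ∈ edgeLikeSubgroups c' e₁ := by
  obtain ⟨v₁, v₂, H₁, H₂, hH₁, hH₂, hne, rfl⟩ := edgeLikeIsInfVerticialAt_holds 𝒢 h𝒢 c e₀ he₀ L hL hLne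
  obtain ⟨w₁, hK₁⟩ := map_mem_verticialSubgroups_of_continuousMulEquiv_of_topCyclic h𝒢 hℋ hcyc𝒢 hcycℋ c c' e hH₁
  obtain ⟨w₂, hK₂⟩ := map_mem_verticialSubgroups_of_continuousMulEquiv_of_topCyclic h𝒢 hℋ hcyc𝒢 hcycℋ c c' e hH₂
  have hinj : Function.Injective e.toMonoidHom := e.injective
  have hmap : (H₁ ⊓ H₂).map e.toMonoidHom = H₁.map e.toMonoidHom ⊓ H₂.map e.toMonoidHom :=
    Subgroup.map_inf_eq H₁ H₂ e.toMonoidHom hinj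
  have hne' : H₁.map e.toMonoidHom ≠ H₂.map e.toMonoidHom := by
    intro h
    apply hne
    have h' := congrArg (Subgroup.map e.symm.toMonoidHom) h
    rwa [map_symm_map_equiv, map_symm_map_equiv] at h'
  have hbot' : H₁.map e.toMonoidHom ⊓ H₂.map e.toMonoidHom ≠ ⊥ := by
    rw [← hmap, Ne, Subgroup.map_eq_bot_iff_of_injective (H₁ ⊓ H₂) hinj]
    exact hLne
  have hanch : H₁.map e.toMonoidHom ⊓ H₁.map e.toMonoidHom ≠ ⊥ := by
    rw [inf_idem]
    exact ne_bot_of_mem_verticialSubgroups hℋ c' hK₁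
  obtain ⟨e₁, he₁, hmem⟩ :=
    ℋ.exists_mem_edgeLikeSubgroups_of_maximalCompact_inf_of_anchored_of_topCyclic hℋ hcycℋ c'
      (ℋ.isMaximalCompactSubgroup_of_mem_verticialSubgroups_of_topCyclic hℋ hcycℋ c' hK₁)
      (ℋ.isMaximalCompactSubgroup_of_mem_verticialSubgroups_of_topCyclic hℋ hcycℋ c' hK₂) hne' hbot' hK₁ hanch
  exact ⟨e₁, he₁, by rw [hmap]; exact hmem⟩

/-- **Two-sided form**: for a nontrivial `L ≤ π₁^temp(𝒢)`, `L` is an edge-like subgroup of some closed edge of `𝒢`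
iff `e(L)` is an edge-like subgroup of some closed edge of `ℋ`. [cite: MochizukiSemiAnbd2006, Cor 3.9 p.43] -/
theorem exists_mem_edgeLikeSubgroups_map_continuousMulEquiv_iff_of_topCyclic
    (h𝒢 : 𝒢.Thm37Hypotheses) (hℋ : ℋ.Thm37Hypotheses)
    (hcyc𝒢 : ∀ e : 𝒢.graph.Edge, ∃ t₀ : 𝒢.Ge e, (Subgroup.zpowers t₀).topologicalClosure = ⊤)
    (hcycℋ : ∀ e : ℋ.graph.Edge, ∃ t₀ : ℋ.Ge e, (Subgroup.zpowers t₀).topologicalClosure = ⊤)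
    (c : TemperedPiChart 𝒢) (c' : TemperedPiChart ℋ) (e : c.G ≃ₜ* c'.G) {L : Subgroup c.G} (hLne : L ≠ ⊥) :
    (∃ e₁ : ℋ.graph.Edge, ℋ.graph.IsClosedEdge e₁ ∧ L.map e.toMonoidHom ∈ edgeLikeSubgroups c' e₁) ↔
      ∃ e₀ : 𝒢.graph.Edge, 𝒢.graph.IsClosedEdge e₀ ∧ L ∈ edgeLikeSubgroups c e₀ := by
  refine ⟨fun ⟨e₁, he₁, h₁⟩ => ?_, fun ⟨e₀, he₀, h₀⟩ =>
    map_mem_edgeLikeSubgroups_of_continuousMulEquiv_of_topCyclic h𝒢 hℋ hcyc𝒢 hcycℋ c c' e he₀ h₀ hLne⟩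
  have hne₁ : L.map e.toMonoidHom ≠ ⊥ := by
    rw [Ne, Subgroup.map_eq_bot_iff_of_injective L e.injective]
    exact hLne
  obtain ⟨e₀, he₀, h₀⟩ :=
    map_mem_edgeLikeSubgroups_of_continuousMulEquiv_of_topCyclic hℋ h𝒢 hcycℋ hcyc𝒢 c' c e.symm he₁ h₁ hne₁
  exact ⟨e₀, he₀, by rwa [map_symm_map_equiv] at h₀⟩

end ProfiniteSemiGraph

end Literature.AnabelianGeometry.SemiGraphs

end
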